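import Summits.ResolutionOfSingularities.ResolutionOfSingularities.Theorems.ValuativeTorsorToLurelFfiniteTower
import Summits.ResolutionOfSingularities.ResolutionOfSingularities.Theorems.ValuativeTorsorToLurelFfiniteAbsorb
import Summits.ResolutionOfSingularities.ResolutionOfSingularities.Theorems.ValuativeTorsorToLurelFfiniteGenerators
import Literature.AlgebraicGeometry.Resolution.AffineModelLU
import Mathlib.FieldTheory.Perfect
import Mathlib.Algebra.CharP.Lemmas

/-!
# Steer core, stub S0 `CompositeRankSS`: the radical tower climbed with ZERO-DIMENSIONAL torsor LU below a transcendence bound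

OURS (campaign res-hironaka, rung L, slot W4.1, crux `Steer` stmt-ResolutionOfSingularities-16345, line
`switching_dichotomy` / res-L0-w41-strat-1's `ss-monomial-cycles` §F, registered frontier stub S0 `CompositeRankSS`; prover
seat res-type-028 gen 8; replaces the role of no printed item; NOT a statement of the manuscript under review; AI-produced,
weaker than expert review). `--supports stmt-ResolutionOfSingularities-16345 --as helper`. Theses-free, definition-free.

This is the trdeg-STRATIFIED, ZERO-DIMENSIONAL twin of the tree's tower climb
`Theorems/FrobeniusClosingTorsorToLurelPerfectStubPerfectTowerClimb.lean` (crux `TorsorToLurelPerfect`, line `temkin-leaf`):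
the same four tower theorems and the absorption step, with the torsor hypothesis `hT` (zero-dimensional torsor LU below `d`) WEAKENED to the induction hypothesis
of the `Steer` skeleton — torsor local uniformization over the fixed ground field `F` only for fields `K'` of
transcendence degree `< d` over `F` and only along valuation rings which are ZERO-DIMENSIONAL over `F` (every element a root
modulo the maximal ideal of a non-zero polynomial over `F`; the line's `TorsorLUZeroDimBelow p d` with `k := F`). The port is
sound because the tree's proofs apply `hT` only at intermediate fields `E ≤ K` with the RESTRICTED valuation ring
`O.comap E.val`, and both side conditions descend: `trdeg_F E ≤ trdeg_F K` (`trdeg_le_of_injective`) and the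
restriction of a zero-dimensional valuation ring is zero-dimensional (same polynomial, `valuation_comap_lt_one_iff`).

* `torsorStep_zeroDim`, `torsorStep_zeroDim_of_pow_mem_adjoin`, `torsorRoot_zeroDim`, `torsorRoots_zeroDim` — the tower;
* `towerAbsorb_zeroDim` — generators + absorption of `R` by normality (`isRegularLocalRing_centre_of_pow_mem`).

Consumer: `Theorems/FrobeniusClosingSteerLUZeroDimOfTorsor.lean` — zero-dimensional LU below `d` from zero-dimensional TORSOR LU
below `d` and Temkin's pushed chart (`stub_perfectChartOfTemkin`, named fact `Temkin2013Relative`), which turns S0's knot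
⟨LUZeroDimBelow p n⟩ into the skeleton's own induction hypothesis modulo that named fact.
-/

noncomputable section

set_option linter.dupNamespace false -- mandated namespace of this single-conjunct summit

open IsLocalRing

namespace Summit.ResolutionOfSingularities.ResolutionOfSingularities.Theorems.ZeroDimTower

open Literature.AlgebraicGeometry.Resolution

section

variable {p d : ℕ} (F : Type) [Field F] {K : Type} [Field K] [Algebra F K] (O : ValuationSubring K)

/-- **One application of `hT` inside `K`**: an `F`-chart `A₀ ⊆ O` and `t ^ p ∈ A₀` give an `F`-chart
`A ⊇ A₀ ∪ {t}` with `F(A) = F(A₀, t)` (`hT` applied to the subfield `E = F(A₀, t)` made a type). -/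
theorem torsorStep_zeroDim
    (hT : ∀ (K : Type) [Field K] [Algebra F K] (O : ValuationSubring K) (A₀ : Subalgebra F K)
      (h₀ : A₀.toSubring ≤ O.toSubring) (t : K), Algebra.trdeg F K < (d : Cardinal) →
      (∀ x : K, x ∈ O → ∃ f : Polynomial F, f ≠ 0 ∧ Polynomial.aeval x f ∈ O.nonunits) →
      A₀.FG → t ^ p ∈ A₀ →
      IsFractionRing (Algebra.adjoin F (insert t (A₀ : Set K))) K → IsRegularLocalRing
        (Localization.AtPrime (Ideal.comap (Subring.inclusion h₀) (maximalIdeal O))) → ∃ (A : Subalgebra F K)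
        (h : A.toSubring ≤ O.toSubring), A₀ ≤ A ∧ t ∈ A ∧ A.FG ∧ IsFractionRing A K ∧
        IsRegularLocalRing (Localization.AtPrime (Ideal.comap (Subring.inclusion h) (maximalIdeal O))))
    (htr : Algebra.trdeg F K < (d : Cardinal))
    (hZ : ∀ x : K, x ∈ O → ∃ f : Polynomial F, f ≠ 0 ∧ Polynomial.aeval x f ∈ O.nonunits)
    (A₀ : Subalgebra F K) (h₀ : A₀.toSubring ≤ O.toSubring)
    (hfg : A₀.FG)
    (hreg : IsRegularLocalRing (Localization.AtPrime
      (Ideal.comap (Subring.inclusion h₀) (maximalIdeal O))))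
    (t : K) (htp : t ^ p ∈ A₀) :
    ∃ (A : Subalgebra F K) (h : A.toSubring ≤ O.toSubring), A₀ ≤ A ∧ t ∈ A ∧ A.FG ∧
      IsRegularLocalRing (Localization.AtPrime
        (Ideal.comap (Subring.inclusion h) (maximalIdeal O))) ∧
      IntermediateField.adjoin F (A : Set K) =
        IntermediateField.adjoin F (insert t (A₀ : Set K)) := by
  classical
  set E : IntermediateField F K := IntermediateField.adjoin F (insert t (A₀ : Set K)) with hE
  let ι : E →+* K := (E.val : E →ₐ[F] K)
  let O' : ValuationSubring E := O.comap ι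
  let A₀' : Subalgebra F E := A₀.comap E.val
  have htE : t ∈ E := IntermediateField.subset_adjoin F _ (Set.mem_insert t _)
  have hA₀E : A₀ ≤ E.val.range := by
    intro x hx
    exact ⟨⟨x, IntermediateField.subset_adjoin F _ (Set.mem_insert_of_mem t hx)⟩, rfl⟩
  have hmap : A₀'.map E.val = A₀ := Subalgebra.map_comap_eq_self hA₀E
  let t' : E := ⟨t, htE⟩
  have h₀' : A₀'.toSubring ≤ O'.toSubring := fun x hx => h₀ (show (x : K) ∈ A₀ from hx)
  have hfg' : A₀'.FG :=
    Subalgebra.fg_of_fg_map _ E.val (fun _ _ h => Subtype.ext h) (by rw [hmap]; exact hfg)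
  have htp' : t' ^ p ∈ A₀' := by change E.val (t' ^ p) ∈ A₀; simpa using htp
  have hadj : (Algebra.adjoin F (insert t' (A₀' : Set E))).map E.val =
      Algebra.adjoin F (insert t (A₀ : Set K)) := by
    have himg : (E.val : E → K) '' (A₀' : Set E) = (A₀ : Set K) := by
      rw [← Subalgebra.coe_map, hmap]
    rw [AlgHom.map_adjoin, Set.image_insert_eq, himg]
    rfl
  have hfrac' : IsFractionRing (Algebra.adjoin F (insert t' (A₀' : Set E))) E := by
    refine IsFractionRing.of_field _ E fun z => ?_
    have hz : (z : K) ∈ IntermediateField.adjoin F (insert t (A₀ : Set K)) := z.2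
    obtain ⟨r, hr, s, hs, hrs⟩ := IntermediateField.mem_adjoin_iff_div.mp hz
    rw [← hadj] at hr hs
    obtain ⟨r', hr', rfl⟩ := Subalgebra.mem_map.mp hr
    obtain ⟨s', hs', rfl⟩ := Subalgebra.mem_map.mp hs
    refine ⟨⟨r', hr'⟩, ⟨s', hs'⟩, Subtype.ext ?_⟩
    simpa using hrs
  have hreg' : IsRegularLocalRing (Localization.AtPrime
      (Ideal.comap (Subring.inclusion h₀') (maximalIdeal O'))) := by
    have hB : A₀'.toSubring.map ι = A₀.toSubring := by
      ext x
      constructor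
      · rintro ⟨y, hy, rfl⟩; exact hy
      · intro hx; obtain ⟨y, rfl⟩ := hA₀E hx; exact ⟨y, hx, rfl⟩
    exact (isRegularLocalRing_centre_map_iff ι O A₀'.toSubring A₀.toSubring hB h₀' h₀).mpr hreg
  -- the two side conditions descend to the intermediate field `E` with the restricted valuation ring `O'`
  have htrE : Algebra.trdeg F E < (d : Cardinal) :=
    lt_of_le_of_lt (trdeg_le_of_injective E.val fun _ _ h => Subtype.ext h) htr
  have hZE : ∀ x : E, x ∈ O' → ∃ f : Polynomial F, f ≠ 0 ∧ Polynomial.aeval x f ∈ O'.nonunits := by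
    intro x hx
    have hxK : (x : K) ∈ O := hx
    obtain ⟨f, hf0, hf⟩ := hZ (x : K) hxK
    refine ⟨f, hf0, ?_⟩
    rw [ValuationSubring.mem_nonunits_iff, valuation_comap_lt_one_iff O ι]
    have hco : ι (Polynomial.aeval x f) = Polynomial.aeval (x : K) f :=
      (Polynomial.aeval_algHom_apply E.val x f).symm
    rw [hco]
    exact (ValuationSubring.mem_nonunits_iff _).mp hf
  obtain ⟨A', h', hle', ht', hfgA', -, hregA'⟩ := hT E O' A₀' h₀' t' htrE hZE hfg' htp' hfrac' hreg'
  let A : Subalgebra F K := A'.map E.val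
  have h : A.toSubring ≤ O.toSubring := by rintro _ ⟨y, hy, rfl⟩; exact h' hy
  refine ⟨A, h, ?_, ⟨t', ht', rfl⟩, hfgA'.map _, ?_, ?_⟩
  · rw [← hmap]; exact Subalgebra.map_mono hle'
  · have hB : A'.toSubring.map ι = A.toSubring := by
      ext x
      constructor
      · rintro ⟨y, hy, rfl⟩; exact ⟨y, hy, rfl⟩
      · rintro ⟨y, hy, rfl⟩; exact ⟨y, hy, rfl⟩
    exact (isRegularLocalRing_centre_map_iff ι O A'.toSubring A.toSubring hB h' h).mp hregA'
  · refine le_antisymm ?_ ?_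
    · rw [IntermediateField.adjoin_le_iff]; rintro _ ⟨y, -, rfl⟩; exact y.2
    · apply IntermediateField.adjoin.mono
      rintro x (rfl | hx)
      · exact ⟨t', ht', rfl⟩
      · rw [← hmap] at hx
        obtain ⟨y, hy, rfl⟩ := Subalgebra.mem_map.mp hx
        exact ⟨y, hle' hy, rfl⟩

/-- **Field form**: as `torsorStep_zeroDim` with only `t ∈ O`, `t ^ p ∈ F(A₀)` (scale `t` by a
denominator). -/
theorem torsorStep_zeroDim_of_pow_mem_adjoin [Fact p.Prime]
    (hT : ∀ (K : Type) [Field K] [Algebra F K] (O : ValuationSubring K) (A₀ : Subalgebra F K)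
      (h₀ : A₀.toSubring ≤ O.toSubring) (t : K), Algebra.trdeg F K < (d : Cardinal) →
      (∀ x : K, x ∈ O → ∃ f : Polynomial F, f ≠ 0 ∧ Polynomial.aeval x f ∈ O.nonunits) →
      A₀.FG → t ^ p ∈ A₀ →
      IsFractionRing (Algebra.adjoin F (insert t (A₀ : Set K))) K → IsRegularLocalRing
        (Localization.AtPrime (Ideal.comap (Subring.inclusion h₀) (maximalIdeal O))) → ∃ (A : Subalgebra F K)
        (h : A.toSubring ≤ O.toSubring), A₀ ≤ A ∧ t ∈ A ∧ A.FG ∧ IsFractionRing A K ∧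
        IsRegularLocalRing (Localization.AtPrime (Ideal.comap (Subring.inclusion h) (maximalIdeal O))))
    (htr : Algebra.trdeg F K < (d : Cardinal))
    (hZ : ∀ x : K, x ∈ O → ∃ f : Polynomial F, f ≠ 0 ∧ Polynomial.aeval x f ∈ O.nonunits)
    (A₀ : Subalgebra F K)
    (h₀ : A₀.toSubring ≤ O.toSubring) (hfg : A₀.FG)
    (hreg : IsRegularLocalRing (Localization.AtPrime
      (Ideal.comap (Subring.inclusion h₀) (maximalIdeal O))))
    (t : K) (ht : t ∈ O) (htp : t ^ p ∈ IntermediateField.adjoin F (A₀ : Set K)) :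
    ∃ (A : Subalgebra F K) (h : A.toSubring ≤ O.toSubring), A₀ ≤ A ∧ A.FG ∧
      IsRegularLocalRing (Localization.AtPrime
        (Ideal.comap (Subring.inclusion h) (maximalIdeal O))) ∧
      IntermediateField.adjoin F (A : Set K) =
        IntermediateField.adjoin F (insert t (A₀ : Set K)) := by
  classical
  obtain ⟨r, hr, s, hs, hrs⟩ := IntermediateField.mem_adjoin_iff_div.mp htp
  rw [Algebra.adjoin_eq] at hr hs
  by_cases hs0 : s = 0
  · -- degenerate: `t = 0`
    have ht0 : t = 0 := by
      have : t ^ p = 0 := by rw [hrs, hs0, div_zero]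
      exact (pow_eq_zero_iff (Nat.Prime.ne_zero Fact.out)).mp this
    refine ⟨A₀, h₀, le_rfl, hfg, hreg, ?_⟩
    rw [ht0]
    refine le_antisymm (IntermediateField.adjoin.mono F _ _ (Set.subset_insert _ _)) ?_
    rw [IntermediateField.adjoin_le_iff]
    rintro x (rfl | hx); exacts [zero_mem _, IntermediateField.subset_adjoin F _ hx]
  · -- scale `t` by the denominator `s`
    set t' : K := t * s with ht'
    obtain ⟨m, hm⟩ : ∃ m : ℕ, p = m + 1 :=
      Nat.exists_eq_add_one_of_ne_zero (Nat.Prime.ne_zero Fact.out)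
    have ht'p : t' ^ p ∈ A₀ := by
      have key : t' ^ p = r * s ^ m := by
        rw [ht', mul_pow, hrs, hm, pow_succ', ← mul_assoc, div_mul_cancel₀ r hs0]
      rw [key]
      exact mul_mem hr (pow_mem hs m)
    obtain ⟨A, h, hle, -, hfgA, hregA, hadjA⟩ :=
      torsorStep_zeroDim F O hT htr hZ A₀ h₀ hfg hreg t' ht'p
    refine ⟨A, h, hle, hfgA, hregA, ?_⟩
    rw [hadjA]
    refine le_antisymm ?_ ?_
    · rw [IntermediateField.adjoin_le_iff]
      rintro x (rfl | hx)
      · exact mul_mem (IntermediateField.subset_adjoin F _ (Set.mem_insert t _))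
          (IntermediateField.subset_adjoin F _ (Set.mem_insert_of_mem t (hs : s ∈ (A₀ : Set K))))
      · exact IntermediateField.subset_adjoin F _ (Set.mem_insert_of_mem t hx)
    · rw [IntermediateField.adjoin_le_iff]
      rintro x (rfl | hx)
      · have hmem : t' * s⁻¹ ∈ IntermediateField.adjoin F (insert t' (A₀ : Set K)) :=
          mul_mem (IntermediateField.subset_adjoin F _ (Set.mem_insert t' _))
            (inv_mem (IntermediateField.subset_adjoin F _
              (Set.mem_insert_of_mem t' (hs : s ∈ (A₀ : Set K)))))
        rwa [ht', mul_inv_cancel_right₀ hs0] at hmem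
      · exact IntermediateField.subset_adjoin F _ (Set.mem_insert_of_mem t' hx)

/-- **Adjoining a `pⁿ`-th root**: `t ∈ O`, `t ^ p ^ n ∈ F(A₀)` (`n` applications of `hT`). -/
theorem torsorRoot_zeroDim [Fact p.Prime]
    (hT : ∀ (K : Type) [Field K] [Algebra F K] (O : ValuationSubring K) (A₀ : Subalgebra F K)
      (h₀ : A₀.toSubring ≤ O.toSubring) (t : K), Algebra.trdeg F K < (d : Cardinal) →
      (∀ x : K, x ∈ O → ∃ f : Polynomial F, f ≠ 0 ∧ Polynomial.aeval x f ∈ O.nonunits) →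
      A₀.FG → t ^ p ∈ A₀ →
      IsFractionRing (Algebra.adjoin F (insert t (A₀ : Set K))) K → IsRegularLocalRing
        (Localization.AtPrime (Ideal.comap (Subring.inclusion h₀) (maximalIdeal O))) → ∃ (A : Subalgebra F K)
        (h : A.toSubring ≤ O.toSubring), A₀ ≤ A ∧ t ∈ A ∧ A.FG ∧ IsFractionRing A K ∧
        IsRegularLocalRing (Localization.AtPrime (Ideal.comap (Subring.inclusion h) (maximalIdeal O))))
    (htr : Algebra.trdeg F K < (d : Cardinal))
    (hZ : ∀ x : K, x ∈ O → ∃ f : Polynomial F, f ≠ 0 ∧ Polynomial.aeval x f ∈ O.nonunits)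
    (n : ℕ) :
    ∀ (A₀ : Subalgebra F K) (h₀ : A₀.toSubring ≤ O.toSubring), A₀.FG →
      IsRegularLocalRing (Localization.AtPrime
        (Ideal.comap (Subring.inclusion h₀) (maximalIdeal O))) →
      ∀ t : K, t ∈ O → t ^ p ^ n ∈ IntermediateField.adjoin F (A₀ : Set K) →
      ∃ (A : Subalgebra F K) (h : A.toSubring ≤ O.toSubring), A₀ ≤ A ∧ A.FG ∧
        IsRegularLocalRing (Localization.AtPrime
          (Ideal.comap (Subring.inclusion h) (maximalIdeal O))) ∧
        IntermediateField.adjoin F (A : Set K) =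
          IntermediateField.adjoin F (insert t (A₀ : Set K)) := by
  induction n with
  | zero =>
    intro A₀ h₀ hfg hreg t _ htp
    refine ⟨A₀, h₀, le_rfl, hfg, hreg, ?_⟩
    rw [pow_zero, pow_one] at htp
    refine le_antisymm (IntermediateField.adjoin.mono F _ _ (Set.subset_insert _ _)) ?_
    rw [IntermediateField.adjoin_le_iff]
    rintro x (rfl | hx); exacts [htp, IntermediateField.subset_adjoin F _ hx]
  | succ n ih =>
    intro A₀ h₀ hfg hreg t ht htp
    have htp' : (t ^ p) ^ p ^ n ∈ IntermediateField.adjoin F (A₀ : Set K) := by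
      rwa [← pow_mul, ← pow_succ']
    obtain ⟨A₁, h₁, hle₁, hfg₁, hreg₁, hadj₁⟩ := ih A₀ h₀ hfg hreg (t ^ p) (pow_mem ht p) htp'
    have htpA₁ : t ^ p ∈ IntermediateField.adjoin F (A₁ : Set K) := by
      rw [hadj₁]
      exact IntermediateField.subset_adjoin F _ (Set.mem_insert _ _)
    obtain ⟨A, h, hle, hfgA, hregA, hadjA⟩ :=
      torsorStep_zeroDim_of_pow_mem_adjoin F O hT htr hZ A₁ h₁ hfg₁ hreg₁ t ht htpA₁
    refine ⟨A, h, hle₁.trans hle, hfgA, hregA, ?_⟩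
    rw [hadjA, adjoin_insert_eq_sup, hadj₁, adjoin_insert_eq_sup, adjoin_insert_eq_sup, ← sup_assoc]
    congr 1
    refine le_antisymm (sup_le le_rfl ?_) le_sup_left
    rw [IntermediateField.adjoin_le_iff, Set.singleton_subset_iff]
    exact pow_mem (IntermediateField.subset_adjoin F _ (Set.mem_singleton t)) p

/-- **Adjoining finitely many `pⁿ`-th roots** `G ⊆ O` with `g ^ p ^ n ∈ F(A₀)`: `F(A) = F(A₀ ∪ G)`. -/
theorem torsorRoots_zeroDim [Fact p.Prime]
    (hT : ∀ (K : Type) [Field K] [Algebra F K] (O : ValuationSubring K) (A₀ : Subalgebra F K)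
      (h₀ : A₀.toSubring ≤ O.toSubring) (t : K), Algebra.trdeg F K < (d : Cardinal) →
      (∀ x : K, x ∈ O → ∃ f : Polynomial F, f ≠ 0 ∧ Polynomial.aeval x f ∈ O.nonunits) →
      A₀.FG → t ^ p ∈ A₀ →
      IsFractionRing (Algebra.adjoin F (insert t (A₀ : Set K))) K → IsRegularLocalRing
        (Localization.AtPrime (Ideal.comap (Subring.inclusion h₀) (maximalIdeal O))) → ∃ (A : Subalgebra F K)
        (h : A.toSubring ≤ O.toSubring), A₀ ≤ A ∧ t ∈ A ∧ A.FG ∧ IsFractionRing A K ∧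
        IsRegularLocalRing (Localization.AtPrime (Ideal.comap (Subring.inclusion h) (maximalIdeal O))))
    (htr : Algebra.trdeg F K < (d : Cardinal))
    (hZ : ∀ x : K, x ∈ O → ∃ f : Polynomial F, f ≠ 0 ∧ Polynomial.aeval x f ∈ O.nonunits)
    (n : ℕ) (G : Finset K) :
    ∀ (A₀ : Subalgebra F K) (h₀ : A₀.toSubring ≤ O.toSubring), A₀.FG →
      IsRegularLocalRing (Localization.AtPrime
        (Ideal.comap (Subring.inclusion h₀) (maximalIdeal O))) →
      (∀ g ∈ G, g ∈ O) → (∀ g ∈ G, g ^ p ^ n ∈ IntermediateField.adjoin F (A₀ : Set K)) →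
      ∃ (A : Subalgebra F K) (h : A.toSubring ≤ O.toSubring), A₀ ≤ A ∧ A.FG ∧
        IsRegularLocalRing (Localization.AtPrime
          (Ideal.comap (Subring.inclusion h) (maximalIdeal O))) ∧
        IntermediateField.adjoin F (A : Set K) =
          IntermediateField.adjoin F ((A₀ : Set K) ∪ G) := by
  classical
  induction G using Finset.induction_on with
  | empty =>
    intro A₀ h₀ hfg hreg _ _
    exact ⟨A₀, h₀, le_rfl, hfg, hreg, by simp⟩
  | insert g G hgG ih =>
    intro A₀ h₀ hfg hreg hGO hGp
    obtain ⟨A₁, h₁, hle₁, hfg₁, hreg₁, hadj₁⟩ := ih A₀ h₀ hfg hreg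
      (fun x hx => hGO x (Finset.mem_insert_of_mem hx))
      (fun x hx => hGp x (Finset.mem_insert_of_mem hx))
    have hg : g ^ p ^ n ∈ IntermediateField.adjoin F (A₁ : Set K) :=
      IntermediateField.adjoin.mono F _ _ (fun x hx => hle₁ hx) (hGp g (Finset.mem_insert_self g G))
    obtain ⟨A, h, hle, hfgA, hregA, hadjA⟩ :=
      torsorRoot_zeroDim F O hT htr hZ n A₁ h₁ hfg₁ hreg₁ g (hGO g (Finset.mem_insert_self g G)) hg
    refine ⟨A, h, hle₁.trans hle, hfgA, hregA, ?_⟩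
    rw [hadjA, Finset.coe_insert, adjoin_insert_eq_sup, hadj₁, Set.union_insert, adjoin_insert_eq_sup]

end

/-- **Tower and absorb over a fixed ground field `F`** (Temkin 2013, Rem. 1.3.5 (ii) over `F` itself):
climb `F(A₀) ⊆ K` through the field generators `G` (`torsorRoots_zeroDim`), then `A := F[A₁, R]`
is regular at the centre by normality (`isRegularLocalRing_centre_of_pow_mem`). -/
theorem towerAbsorb_zeroDim (p : ℕ) {d : ℕ} [Fact p.Prime] {F : Type} [Field F] [CharP F p]
    (hT : ∀ (K : Type) [Field K] [Algebra F K] (O : ValuationSubring K)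
      (A₀ : Subalgebra F K) (h₀ : A₀.toSubring ≤ O.toSubring) (t : K), Algebra.trdeg F K < (d : Cardinal) →
      (∀ x : K, x ∈ O → ∃ f : Polynomial F, f ≠ 0 ∧ Polynomial.aeval x f ∈ O.nonunits) →
      A₀.FG → t ^ p ∈ A₀ →
      IsFractionRing (Algebra.adjoin F (insert t (A₀ : Set K))) K →
      IsRegularLocalRing (Localization.AtPrime
        (Ideal.comap (Subring.inclusion h₀) (maximalIdeal O))) →
      ∃ (A : Subalgebra F K) (h : A.toSubring ≤ O.toSubring), A₀ ≤ A ∧ t ∈ A ∧ A.FG ∧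
        IsFractionRing A K ∧
        IsRegularLocalRing (Localization.AtPrime
          (Ideal.comap (Subring.inclusion h) (maximalIdeal O))))
    (K : Type) [Field K] [Algebra F K] (O : ValuationSubring K)
    (htr : Algebra.trdeg F K < (d : Cardinal))
    (hZ : ∀ x : K, x ∈ O → ∃ f : Polynomial F, f ≠ 0 ∧ Polynomial.aeval x f ∈ O.nonunits)
    (R : Subalgebra F K) (hRfg : R.FG) (hRO : R.toSubring ≤ O.toSubring)
    (G : Finset K) (hGO : ∀ g ∈ G, g ∈ O) (hGtop : IntermediateField.adjoin F (G : Set K) = ⊤)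
    (m : ℕ) (A₀ : Subalgebra F K) (h₀ : A₀.toSubring ≤ O.toSubring) (hA₀fg : A₀.FG)
    (hreg₀ : IsRegularLocalRing (Localization.AtPrime
      (Ideal.comap (Subring.inclusion h₀) (maximalIdeal O))))
    (hRpow : ∀ r ∈ R, r ^ p ^ m ∈ A₀)
    (hGpow : ∀ g ∈ G, g ^ p ^ m ∈ IntermediateField.adjoin F (A₀ : Set K)) :
    ∃ (A : Subalgebra F K) (h : A.toSubring ≤ O.toSubring), R ≤ A ∧ A.FG ∧ IsFractionRing A K ∧
      IsRegularLocalRing (Localization.AtPrime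
        (Ideal.comap (Subring.inclusion h) (maximalIdeal O))) := by
  classical
  have hp : p.Prime := Fact.out
  -- Step 1: climb the `p`-radical tower `F(A₀) ⊆ K` with the fixed-field torsor hypothesis
  obtain ⟨A₁, h₁, hle₁, hfg₁, hreg₁, hadj₁⟩ :=
    torsorRoots_zeroDim F O hT htr hZ m G A₀ h₀ hA₀fg hreg₀ hGO hGpow
  have htop : IntermediateField.adjoin F (A₁ : Set K) = ⊤ := by
    refine eq_top_iff.mpr ?_
    rw [← hGtop, hadj₁]
    exact IntermediateField.adjoin.mono F _ _ Set.subset_union_right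
  haveI hA₁fr : IsFractionRing A₁.toSubring K := by
    refine IsFractionRing.of_field A₁.toSubring K fun z => ?_
    have hz : z ∈ IntermediateField.adjoin F (A₁ : Set K) := by
      rw [htop]; exact IntermediateField.mem_top
    obtain ⟨r, hr, s, hs, rfl⟩ := IntermediateField.mem_adjoin_iff_div.mp hz
    rw [Algebra.adjoin_eq] at hr hs
    exact ⟨⟨r, hr⟩, ⟨s, hs⟩, rfl⟩
  -- Step 2: the chart `A := F[A₁, R]`
  obtain ⟨S₁, hS₁⟩ := hfg₁
  obtain ⟨SR, hSR⟩ := hRfg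
  let A : Subalgebra F K := Algebra.adjoin F ((S₁ ∪ SR : Finset K) : Set K)
  have hS₁A₁ : (S₁ : Set K) ⊆ A₁ := by rw [← hS₁]; exact Algebra.subset_adjoin
  have hSRR : (SR : Set K) ⊆ R := by rw [← hSR]; exact Algebra.subset_adjoin
  have hA₁A' : A₁ ≤ A := by
    rw [← hS₁]
    exact Algebra.adjoin_mono (by rw [Finset.coe_union]; exact Set.subset_union_left)
  have hRA : R ≤ A := by
    rw [← hSR]
    exact Algebra.adjoin_mono (by rw [Finset.coe_union]; exact Set.subset_union_right)
  have hA₁A : A₁.toSubring ≤ A.toSubring := fun x hx => hA₁A' hx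
  have hO : ∀ c : F, algebraMap F K c ∈ O := fun c => h₀ (A₀.algebraMap_mem c)
  let Oalg : Subalgebra F K := { O.toSubring with algebraMap_mem' := hO }
  have hAO : A.toSubring ≤ O.toSubring := by
    have hle : A ≤ Oalg := Algebra.adjoin_le (by
      rw [Finset.coe_union]
      rintro x (hx | hx)
      · exact h₁ (hS₁A₁ hx)
      · exact hRO (hSRR hx))
    exact fun x hx => hle hx
  -- Step 3: every element of `A` has its `p^m`-th power in `A₁`
  haveI : CharP K p := (Algebra.charP_iff F K p).mp inferInstance
  have hpow : ∀ x ∈ A.toSubring, x ^ p ^ m ∈ A₁.toSubring := by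
    let C : Subalgebra F K :=
      { A₁.toSubring.comap (iterateFrobenius K p m) with
        algebraMap_mem' := fun c => by
          change iterateFrobenius K p m (algebraMap F K c) ∈ A₁.toSubring
          rw [iterateFrobenius_def, ← map_pow]
          exact A₁.algebraMap_mem _ }
    have hAC : A ≤ C := Algebra.adjoin_le (by
      rw [Finset.coe_union]
      rintro x (hx | hx)
      · change iterateFrobenius K p m x ∈ A₁.toSubring
        rw [iterateFrobenius_def]
        exact pow_mem (hS₁A₁ hx) _
      · change iterateFrobenius K p m x ∈ A₁.toSubring
        rw [iterateFrobenius_def]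
        exact hle₁ (hRpow x (hSRR hx)))
    intro x hx
    have := hAC hx
    change iterateFrobenius K p m x ∈ A₁.toSubring at this
    rwa [iterateFrobenius_def] at this
  -- Step 4: absorb by normality of the regular centre
  have hregA := isRegularLocalRing_centre_of_pow_mem O A₁.toSubring A.toSubring hA₁A h₁ hAO
    (pow_pos hp.pos m) hpow hreg₁
  refine ⟨A, hAO, hRA, ⟨_, rfl⟩, ?_, hregA⟩
  refine IsFractionRing.of_field A K fun z => ?_
  obtain ⟨a, b, -, rfl⟩ := IsFractionRing.div_surjective (A := A₁.toSubring) z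
  exact ⟨⟨a, hA₁A a.2⟩, ⟨b, hA₁A b.2⟩, rfl⟩

end Summit.ResolutionOfSingularities.ResolutionOfSingularities.Theorems.ZeroDimTower

end
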